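import Literature.AlgebraicGeometry.HodgeTheory.GAGADimensionProofs
import Literature.AlgebraicGeometry.Motives.CartierDivisorOfComplement
import HarnessLib

/-!
# GAGA: the algebraic local equation of a prime divisor is an analytic local coordinate at its simple points

Support for GAGA for line bundles (`GAGALineBundles*`; J.-P. Serre, *Géométrie algébrique et
géométrie analytique* (1956), n° 20 Remarque 1 with §1 n°4 and §2 n°6 Cor. 2: at a simple point of
a subvariety the analytic space is a submanifold whose local equations are the algebraic ones).
The tree's proof of `gaga_le_coheight_of_regularLocus_codim` (`GAGADimensionProofs`) produces ONE
simple point of an irreducible subvariety; here the same commutative algebra is made UNIFORM on a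
dense open subset of a prime divisor `Y` of a smooth projective `X/ℂ`, and transported to an
arbitrary analytification `φ : M → X(ℂ)`:

* `GAGADimension.exists_forall_isRegularLocalRing` — **generic smoothness, open form**: a finitely
  generated domain `B` over a perfect field has a non-zero `b` with `B_𝔫` regular for every prime
  `𝔫 ∌ b` (the smooth locus is open and contains the generic point; Görtz–Wedhorn I Thm. 6.19,
  Lemma 6.26; Mathlib `Algebra.isOpen_smoothLocus`, `Algebra.IsSmoothAt.exists_notMem_isStandardSmooth`);
* `GAGADimension.exists_uniformSimplePointData` — for a prime `𝔭` of height `c` in a standard smooth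
  domain `A` of relative dimension `n` over an algebraically closed `K`: generators `g₁, …, g_c` of `𝔭`
  off `V(h)` (`h ∉ 𝔭`) such that at EVERY maximal `𝔪 ⊇ 𝔭` off `V(h)` the `gⱼ` are linearly independent
  modulo `𝔪²` and local coordinates modulo `𝔪²` exist (Serre §1 n°4: all points of `V(𝔭) ∩ D(h)` are
  simple points of `V(𝔭)`);
* `exists_chart_mfderiv_ne_zero` — **for a prime divisor `Y ⊆ X`** (closed, irreducible, generic
  point of codimension `1`) on a smooth projective `X/ℂ` with analytification `φ : M → X(ℂ)`
  (holomorphic atlas): a local equation `j ∈ Γ(X, W)` of the reduced divisor `Y` on an affine open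
  `W` meeting `Y` — a `ComplementDivisor.Chart` of `X ∖ Y` in the sense of
  `Motives/CartierDivisorOfComplement` (`j` a unit exactly off `Y`, generating a radical ideal at each
  point of `W`) — whose pull-back `m ↦ j(φ m)` has NON-ZERO DIFFERENTIAL at every point of
  `φ⁻¹((Y ∩ W)(ℂ))`. The differential is computed in the algebraic-chart model of `X^h`
  (`GAGADimension.surjective_pi_fderiv_chart`) and moved to `M` by the uniqueness of the
  analytification (`IsAnalytification.unique_holds`).

Everything is proved; no named facts.

## References

* [SerreGAGA1956] J.-P. Serre, Géométrie algébrique et géométrie analytique, Ann. Inst. Fourier 6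
  (1956), §1 n°4, §2 n°6 Prop. 3 Cor. 2, n° 20 Remarque 1.
* [GortzWedhorn2020] U. Görtz, T. Wedhorn, Algebraic Geometry I, 2nd ed. (2020), Thm. 6.19,
  Lemma 6.26.
-/

noncomputable section

open scoped Manifold ContDiff Topology
open CategoryTheory AlgebraicGeometry Filter IsLocalRing
open Literature.AlgebraicGeometry.Motives
open Literature.AlgebraicGeometry.Motives.AlgPoints (evalOrZero evalOrZero_of_mem evalOrZero_of_not_mem)
open Literature.NumberTheory.Transcendental

universe u

namespace Literature.AlgebraicGeometry.HodgeTheory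

namespace GAGADimension

/-! ### Generic smoothness, open form -/

/-- **Generic smoothness of an affine domain over a perfect field, open form**: there is `b ≠ 0`
in `B` such that `B_𝔫` is a regular local ring for every prime `𝔫 ∌ b` (the smooth locus of
`Spec B → Spec K` is open and contains the generic point, and smooth points are regular).
[cite: GortzWedhorn2020, Thm. 6.19 and Lemma 6.26] -/
theorem exists_forall_isRegularLocalRing (K : Type*) [Field K] [PerfectField K] (B : Type*)
    [CommRing B] [IsDomain B] [Algebra K B] [Algebra.FiniteType K B] :
    ∃ b : B, b ≠ 0 ∧ ∀ (𝔫 : Ideal B) [𝔫.IsPrime], b ∉ 𝔫 → IsRegularLocalRing (Localization.AtPrime 𝔫) := by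
  classical
  haveI : IsNoetherianRing B := Algebra.FiniteType.isNoetherianRing K B
  haveI : Algebra.FinitePresentation K B := (Algebra.FinitePresentation.of_finiteType).mp ‹_›
  have hopen : IsOpen (Algebra.smoothLocus K B) := Algebra.isOpen_smoothLocus
  have hbot : (⟨⊥, Ideal.isPrime_bot⟩ : PrimeSpectrum B) ∈ Algebra.smoothLocus K B := isSmoothAt_bot K B
  obtain ⟨_, ⟨b, rfl⟩, hbmem, hbsub⟩ :=
    PrimeSpectrum.isTopologicalBasis_basic_opens.exists_subset_of_mem_open hbot hopen
  refine ⟨b, ?_, fun 𝔫 _ hb𝔫 ↦ ?_⟩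
  · intro hb0
    rw [hb0] at hbmem
    exact hbmem (show (0 : B) ∈ (⊥ : Ideal B) from Submodule.zero_mem _)
  · have hx : (⟨𝔫, inferInstance⟩ : PrimeSpectrum B) ∈ Algebra.smoothLocus K B := hbsub hb𝔫
    haveI : Algebra.IsSmoothAt K 𝔫 := hx
    obtain ⟨f, hf, hstd⟩ := Algebra.IsSmoothAt.exists_notMem_isStandardSmooth K 𝔫
    obtain ⟨ι, τ, _, _, ⟨P⟩⟩ := hstd.out
    haveI := P.isStandardSmoothOfRelativeDimension rfl
    have hdisj : Disjoint (Submonoid.powers f : Set B) 𝔫 := by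
      rw [Ideal.disjoint_powers_iff_notMem_of_isPrime]
      exact hf
    set 𝔫' : Ideal (Localization.Away f) := 𝔫.map (algebraMap B _) with h𝔫'
    haveI : 𝔫'.IsPrime := IsLocalization.isPrime_of_isPrime_disjoint (.powers f) _ _ inferInstance hdisj
    have hreg := Literature.AlgebraicGeometry.Motives.isRegularLocalRing_of_isStandardSmoothOfRelativeDimension
      K P.dimension 𝔫'
    have hunder : 𝔫'.comap (algebraMap B (Localization.Away f)) = 𝔫 :=
      IsLocalization.under_map_of_isPrime_disjoint (.powers f) _ inferInstance hdisj
    let e := IsLocalization.localizationLocalizationAtPrimeIsoLocalization (Submonoid.powers f) 𝔫'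
    haveI := hreg
    have hreg' : IsRegularLocalRing
        (Localization.AtPrime (𝔫'.comap (algebraMap B (Localization.Away f)))) :=
      IsRegularLocalRing.of_ringEquiv e.symm.toRingEquiv
    have transfer : ∀ (J : Ideal B) (hJ : J.IsPrime), J = 𝔫 →
        IsRegularLocalRing (Localization.AtPrime J) → IsRegularLocalRing (Localization.AtPrime 𝔫) := by
      rintro J hJ rfl h
      exact h
    exact transfer _ inferInstance hunder hreg'

/-! ### Uniform simple-point data along `V(𝔭) ∩ D(h)` -/

/-- **All points of `V(𝔭) ∩ D(h)` are simple points** (uniform version of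
`exists_simplePointData`). Let `A` be a domain, standard smooth of relative dimension `n` over an
algebraically closed field `K`, and `𝔭 ⊂ A` a prime of height `c`. Then there are
`g₁, …, g_c ∈ 𝔭` and `h ∉ 𝔭` with `h · 𝔭 ⊆ (g)` such that for EVERY maximal ideal `𝔪 ⊇ 𝔭` with
`h ∉ 𝔪`: the `gⱼ` are linearly independent modulo `𝔪²` over `K`, and there are local coordinates
`t₁, …, tₙ ∈ 𝔪` spanning `𝔪` modulo `𝔪²` over `K` (`𝔪` being `K`-rational by the Nullstellensatz).
The element `h` also kills the non-regular locus of `A/𝔭` (`exists_forall_isRegularLocalRing`).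
[cite: SerreGAGA1956, §1 n°4 and §2 n°6 Cor. 2] [cite: GortzWedhorn2020, Thm. 6.19 and Lemma 6.26] -/
theorem exists_uniformSimplePointData (K : Type*) [Field K] [IsAlgClosed K] (A : Type u)
    [CommRing A] [IsDomain A] [Algebra K A] (n : ℕ) [Algebra.IsStandardSmoothOfRelativeDimension n K A]
    (𝔭 : Ideal A) [𝔭.IsPrime] {c : ℕ} (hc : 𝔭.height = c) :
    ∃ (g : Fin c → A) (h : A), (∀ j, g j ∈ 𝔭) ∧ h ∉ 𝔭 ∧ (∀ a ∈ 𝔭, h * a ∈ Ideal.span (Set.range g)) ∧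
      ∀ (𝔪 : Ideal A), 𝔪.IsMaximal → 𝔭 ≤ 𝔪 → h ∉ 𝔪 →
        (∀ coef : Fin c → K, ∑ j, coef j • g j ∈ 𝔪 ^ 2 → coef = 0) ∧
        ∃ t : Fin n → A, (∀ i, t i ∈ 𝔪) ∧
          ∀ a ∈ 𝔪, ∃ coef : Fin n → K, a - ∑ i, coef i • t i ∈ 𝔪 ^ 2 := by
  classical
  haveI : Algebra.IsStandardSmooth K A :=
    Algebra.IsStandardSmoothOfRelativeDimension.isStandardSmooth n
  haveI : Algebra.FiniteType K A := inferInstance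
  haveI : IsNoetherianRing A := Algebra.FiniteType.isNoetherianRing K A
  have hdimA : ringKrullDim A = n :=
    Literature.AlgebraicGeometry.Motives.ringKrullDim_eq_of_isStandardSmoothOfRelativeDimension K n
  -- `A_𝔭` regular of dimension `c`: generators `g` of `𝔭` off `V(h')`
  haveI := Literature.AlgebraicGeometry.Motives.isRegularLocalRing_of_isStandardSmoothOfRelativeDimension
    K n 𝔭
  have hdim𝔭 : ringKrullDim (Localization.AtPrime 𝔭) = c := by
    rw [IsLocalization.AtPrime.ringKrullDim_eq_height 𝔭, hc]
    rfl
  obtain ⟨g, hg, h', hh', hgen⟩ := exists_mul_mem_span_of_isRegularLocalRing 𝔭 hdim𝔭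
  -- `B = A/𝔭` of dimension `d`, `c + d = n`, regular off `V(b̄)`
  obtain ⟨d, hd⟩ := Literature.AlgebraicGeometry.Motives.exists_ringKrullDim_eq_natCast K (A ⧸ 𝔭)
  have hcd : c + d = n := by
    have h1 := Literature.AlgebraicGeometry.Motives.Ideal.height_add_ringKrullDim_quotient K A 𝔭
    rw [hc, hd, hdimA] at h1
    exact_mod_cast h1
  haveI : Algebra.FiniteType K (A ⧸ 𝔭) :=
    (inferInstance : Algebra.FiniteType K A).of_surjective (Ideal.Quotient.mkₐ K 𝔭)
      (Ideal.Quotient.mkₐ_surjective K 𝔭)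
  obtain ⟨bbar, hbbar, hregB⟩ := exists_forall_isRegularLocalRing K (A ⧸ 𝔭)
  obtain ⟨b, rfl⟩ := Ideal.Quotient.mk_surjective bbar
  have hb𝔭 : b ∉ 𝔭 := fun hb ↦ hbbar (Ideal.Quotient.eq_zero_iff_mem.2 hb)
  refine ⟨g, h' * b, hg, fun hm ↦ (Ideal.IsPrime.mem_or_mem inferInstance hm).elim hh' hb𝔭,
    fun a ha ↦ by rw [mul_comm h' b, mul_assoc]; exact Ideal.mul_mem_left _ _ (hgen a ha), ?_⟩
  intro 𝔪 h𝔪max h𝔭𝔪 hh𝔪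
  haveI := h𝔪max
  have hh'𝔪 : h' ∉ 𝔪 := fun hm ↦ hh𝔪 (Ideal.mul_mem_right _ _ hm)
  have hb𝔪 : b ∉ 𝔪 := fun hm ↦ hh𝔪 (Ideal.mul_mem_left _ _ hm)
  -- the maximal ideal `𝔫 = 𝔪/𝔭` of `A/𝔭`
  set 𝔫 : Ideal (A ⧸ 𝔭) := 𝔪.map (Ideal.Quotient.mk 𝔭) with h𝔫def
  have hcomap : 𝔫.comap (Ideal.Quotient.mk 𝔭) = 𝔪 := by
    rw [h𝔫def, Ideal.comap_map_of_surjective _ Ideal.Quotient.mk_surjective, ← RingHom.ker_eq_comap_bot,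
      Ideal.mk_ker, sup_eq_left]
    exact h𝔭𝔪
  haveI h𝔫max : 𝔫.IsMaximal := by
    refine (Ideal.map_eq_top_or_isMaximal_of_surjective _ Ideal.Quotient.mk_surjective h𝔪max).resolve_left
      fun htop ↦ h𝔪max.ne_top ?_
    rw [← hcomap, h𝔫def, htop, Ideal.comap_top]
  have hb𝔫 : Ideal.Quotient.mk 𝔭 b ∉ 𝔫 := fun hmem ↦ hb𝔪 (by
    have : b ∈ 𝔫.comap (Ideal.Quotient.mk 𝔭) := hmem
    rwa [hcomap] at this)
  haveI hreg𝔫 : IsRegularLocalRing (Localization.AtPrime 𝔫) := hregB 𝔫 hb𝔫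
  -- `(A/𝔭)_𝔫` has dimension `d`
  have hdim𝔫 : ringKrullDim (Localization.AtPrime 𝔫) = d := by
    let x : PrimeSpectrum (A ⧸ 𝔭) := ⟨𝔫, h𝔫max.isPrime⟩
    have h1 := Literature.AlgebraicGeometry.Motives.height_add_coheight_eq_of_isDomain K d (A ⧸ 𝔭) hd x
    have h2 : Order.coheight x = 0 := by
      rw [Order.coheight_eq_zero]
      intro y hy
      have : y.asIdeal = 𝔫 := (h𝔫max.eq_of_le y.2.ne_top hy).symm
      exact le_of_eq (PrimeSpectrum.ext this)
    rw [h2, add_zero] at h1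
    rw [IsLocalization.AtPrime.ringKrullDim_eq_height 𝔫,
      show 𝔫 = x.asIdeal from rfl, PrimeSpectrum.height_eq_orderHeight, h1]
    rfl
  -- replace `𝔪` by `𝔫 ∩ A`
  clear_value 𝔫
  subst hcomap
  obtain ⟨s, hs, hspan⟩ := maximalIdeal_le_span_of_quotient 𝔭 𝔫 hdim𝔫 g h' hh'𝔪 hgen
  -- `A_𝔪` is regular of dimension `n = c + d`; independence of the `gⱼ`
  have hdim𝔪 : ringKrullDim (Localization.AtPrime (𝔫.comap (Ideal.Quotient.mk 𝔭))) = (c + d : ℕ) := by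
    rw [IsLocalization.AtPrime.ringKrullDim_eq_height (𝔫.comap (Ideal.Quotient.mk 𝔭)),
      Literature.AlgebraicGeometry.Motives.height_eq_of_isStandardSmoothOfRelativeDimension K n
        (𝔫.comap (Ideal.Quotient.mk 𝔭)), hcd]
    rfl
  have hindep : ∀ coef : Fin c → K, ∑ j, coef j • g j ∈ 𝔫.comap (Ideal.Quotient.mk 𝔭) ^ 2 → coef = 0 :=
    fun coef hmem ↦ eq_zero_of_sum_smul_mem_sq K (𝔫.comap (Ideal.Quotient.mk 𝔭)) hdim𝔪 g s
      (fun j ↦ h𝔭𝔪 (hg j)) hs hspan coef hmem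
  set 𝔪 := 𝔫.comap (Ideal.Quotient.mk 𝔭) with h𝔪def
  -- `𝔪` is `K`-rational (Nullstellensatz) and local coordinates at `𝔪`
  letI : Field (A ⧸ 𝔪) := Ideal.Quotient.field 𝔪
  haveI : Module.Finite K (A ⧸ 𝔪) := finite_of_finite_type_of_isJacobsonRing K (A ⧸ 𝔪)
  haveI : Algebra.IsIntegral K (A ⧸ 𝔪) := Algebra.IsIntegral.of_finite K _
  have hbij := IsAlgClosed.algebraMap_bijective_of_isIntegral (k := K) (K := A ⧸ 𝔪)
  let e : K ≃ₐ[K] (A ⧸ 𝔪) := AlgEquiv.ofBijective (Algebra.ofId K (A ⧸ 𝔪)) hbij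
  let ψ : A →ₐ[K] K := (e.symm : (A ⧸ 𝔪) →ₐ[K] K).comp (Ideal.Quotient.mkₐ K 𝔪)
  have hψ : ∀ a, ψ a = 0 ↔ a ∈ 𝔪 := fun a ↦ by
    change e.symm (Ideal.Quotient.mk 𝔪 a) = 0 ↔ a ∈ 𝔪
    rw [map_eq_zero_iff _ e.symm.injective, Ideal.Quotient.eq_zero_iff_mem]
  haveI := Literature.AlgebraicGeometry.Motives.isRegularLocalRing_of_isStandardSmoothOfRelativeDimension
    K n 𝔪
  have hdim𝔪' : ringKrullDim (Localization.AtPrime 𝔪) = n := by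
    rw [IsLocalization.AtPrime.ringKrullDim_eq_height 𝔪,
      Literature.AlgebraicGeometry.Motives.height_eq_of_isStandardSmoothOfRelativeDimension K n 𝔪]
    rfl
  obtain ⟨t, ht, htspan⟩ := exists_sub_sum_smul_mem_sq K 𝔪 hdim𝔪' ψ hψ
  exact ⟨hindep, t, ht, htspan⟩

end GAGADimension

/-! ### The local equation of a prime divisor has non-zero differential at its simple points -/

set_option backward.isDefEq.respectTransparency false in
open GAGADimension ComplementDivisor RatFn in
/-- **The algebraic local equation of a prime divisor is an analytic local coordinate on a dense
open subset of it.** Let `X` be smooth projective of dimension `n` over `ℂ`, `φ : M → X(ℂ)` an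
analytification with a holomorphic atlas on `M`, and `Y ⊆ X` closed with generic point `η` of
codimension `1` (a prime divisor). Then there is a local equation of the reduced divisor `Y` — an
affine open `W ∋ η` and `j ∈ Γ(X, W)` which is a unit exactly off `Y` and generates a radical ideal of
every `𝒪_{X,y}`, `y ∈ W` (a `ComplementDivisor.Chart` of `X ∖ Y`) — such that the holomorphic function
`m ↦ j(φ m)` has non-zero differential at every point `m` of `φ⁻¹((Y ∩ W)(ℂ))`. Construction: on a
standard smooth affine chart `U = Spec A ∋ η` with `𝔭 = 𝔭_η` of height `1`,
`exists_uniformSimplePointData` gives `g ∈ 𝔭`, `h ∉ 𝔭` with `h 𝔭 ⊆ (g)` and `g ∉ 𝔪²` at every closed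
point `𝔪` of `V(𝔭) ∩ D(h)`; take `W = D(h)`, `j = g`. At such a point `dg ≠ 0` in the algebraic-chart
model of `X^h` (`surjective_pi_fderiv_chart`), hence on `M` (`IsAnalytification.unique_holds`). Serre,
GAGA n° 20 Remarque 1 uses exactly this: the divisor of a section is read off algebraic local
equations. [cite: SerreGAGA1956, §2 n°6 Cor. 2 with §1 n°4; n° 20 Remarque 1] -/
theorem exists_chart_mfderiv_ne_zero {n : ℕ} {X : SchemeOver ℂ} (hX : IsSmoothProjective n X)
    [IsIntegral X.left]
    {E : Type} [NormedAddCommGroup E] [NormedSpace ℂ E] [FiniteDimensional ℂ E]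
    {M : Type} [TopologicalSpace M] [ChartedSpace E M] [IsManifold 𝓘(ℂ, E) ω M]
    {φ : M → ComplexPoints X} (hφ : IsAnalytification E X n φ)
    {Y : Set X.left} (hY : IsClosed Y) {η : X.left} (hη : IsGenericPoint η Y)
    (hcoh : Order.coheight η = 1) :
    ∃ c : ComplementDivisor.Chart (⟨Yᶜ, hY.isOpen_compl⟩ : X.left.Opens),
      η ∈ c.W ∧ ∀ m : M, (φ m).pt ∈ c.W → (φ m).pt ∈ Y →
        mfderiv 𝓘(ℂ, E) 𝓘(ℂ, ℂ) (fun m' ↦ evalOrZero c.W c.j (φ m')) m ≠ 0 := by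
  classical
  haveI := hX.smoothOfRelativeDimension
  haveI : LocallyOfFiniteType X.hom := by
    haveI : Smooth X.hom := SmoothOfRelativeDimension.smooth n _
    infer_instance
  -- Step 1: a standard smooth affine chart `U = Spec A ∋ η`
  obtain ⟨U, hU, hηU, hsm⟩ := exists_isStandardSmoothOfRelativeDimension_scalarRingHom' X n η
  letI : Algebra ℂ Γ(X.left, U) := (SchemeOver.scalarRingHom X U).toAlgebra
  haveI : Algebra.IsStandardSmoothOfRelativeDimension n ℂ Γ(X.left, U) := hsm
  haveI : Nonempty U := ⟨⟨η, hηU⟩⟩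
  haveI : IsDomain Γ(X.left, U) := IsIntegral.component_integral U
  haveI : Algebra.IsStandardSmooth ℂ Γ(X.left, U) :=
    Algebra.IsStandardSmoothOfRelativeDimension.isStandardSmooth n
  haveI : IsNoetherianRing Γ(X.left, U) := Algebra.FiniteType.isNoetherianRing ℂ _
  -- Step 2: the prime `𝔭` of `η`; `Y ∩ U = V(𝔭)`; `ht 𝔭 = 1`
  set pη : Spec Γ(X.left, U) := hU.primeIdealOf ⟨η, hηU⟩ with hpηdef
  set 𝔭 : Ideal Γ(X.left, U) := pη.asIdeal with h𝔭def
  haveI h𝔭prime : 𝔭.IsPrime := pη.2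
  have hmemY : ∀ y : U, (y : X.left) ∈ Y ↔ 𝔭 ≤ (hU.primeIdealOf y).asIdeal := by
    intro y
    have h1 := hU.fromSpec.isOpenEmbedding.isInducing.specializes_iff (x := pη) (y := hU.primeIdealOf y)
    rw [hpηdef, hU.fromSpec_primeIdealOf, hU.fromSpec_primeIdealOf] at h1
    rw [← hη.specializes_iff_mem, h𝔭def, PrimeSpectrum.asIdeal_le_asIdeal, PrimeSpectrum.le_iff_specializes,
      hpηdef]
    exact h1
  have hht : 𝔭.height = (1 : ℕ) := by
    rw [h𝔭def, idealHeight_eq_coheight, ← coheight_eq_of_isOpenImmersion hU.fromSpec, hpηdef,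
      hU.fromSpec_primeIdealOf]
    exact hcoh
  -- Step 3: uniform simple-point data: `g ∈ 𝔭`, `h ∉ 𝔭`, `h 𝔭 ⊆ (g)`
  obtain ⟨g, h, hg𝔭, hh𝔭, hgen, hdata⟩ := exists_uniformSimplePointData ℂ Γ(X.left, U) n 𝔭 hht
  have hbasic : ∀ (y : U) (f : Γ(X.left, U)), (y : X.left) ∈ X.left.basicOpen f ↔
      f ∉ (hU.primeIdealOf y).asIdeal := fun y f ↦ mem_basicOpen_iff_notMem_primeIdealOf hU y f
  have hηh : η ∈ X.left.basicOpen h := (hbasic ⟨η, hηU⟩ h).2 hh𝔭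
  -- on `D(h)`: `𝔭 ≤ 𝔮_y ↔ g₀ ∈ 𝔮_y`
  have hle_iff : ∀ y : U, h ∉ (hU.primeIdealOf y).asIdeal →
      (𝔭 ≤ (hU.primeIdealOf y).asIdeal ↔ g 0 ∈ (hU.primeIdealOf y).asIdeal) := by
    intro y hhy
    refine ⟨fun hle ↦ hle (hg𝔭 0), fun hg0 a ha ↦ ?_⟩
    have h1 : h * a ∈ (hU.primeIdealOf y).asIdeal := by
      refine (Ideal.span_le.2 ?_ : Ideal.span (Set.range g) ≤ _) (hgen a ha)
      rintro _ ⟨j, rfl⟩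
      rwa [Subsingleton.elim j 0]
    exact ((hU.primeIdealOf y).2.mem_or_mem h1).resolve_left hhy
  -- `g₀ ≠ 0` (otherwise `𝔭 = 0`, of height `0`)
  have hg0 : g 0 ≠ 0 := by
    intro h0
    have hbot : 𝔭 = ⊥ := by
      refine le_bot_iff.1 fun a ha ↦ ?_
      have h1 := hgen a ha
      have hrange : Set.range g = {0} := by
        ext x
        simp only [Set.mem_range, Set.mem_singleton_iff]
        exact ⟨fun ⟨j, hj⟩ ↦ by rw [← hj, Subsingleton.elim j 0, h0], fun hx ↦ ⟨0, by rw [h0, hx]⟩⟩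
      rw [hrange, Ideal.span_singleton_eq_bot.2 rfl, Ideal.mem_bot, mul_eq_zero] at h1
      exact h1.resolve_left fun hh ↦ hh𝔭 (hh ▸ zero_mem 𝔭)
    have : (⊥ : Ideal Γ(X.left, U)).height = (1 : ℕ) := hbot ▸ hht
    rw [Ideal.height_bot] at this
    exact absurd this (by simp)
  -- Step 4: the chart `W = D(h)`, `j = g₀|_W`
  have hW : IsAffineOpen (X.left.basicOpen h) := hU.basicOpen h
  have hWU : X.left.basicOpen h ≤ U := X.left.basicOpen_le h
  let ηW : X.left.basicOpen h := ⟨η, hηh⟩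
  haveI : Nonempty (X.left.basicOpen h : X.left.Opens) := ⟨ηW⟩
  set jW := X.left.presheaf.map (homOfLE hWU).op (g 0) with hjW
  have hfn : toFunctionField (ηW : X.left) (X.left.presheaf.germ (X.left.basicOpen h) ηW ηW.2 jW) =
      algebraMap Γ(X.left, U) X.left.functionField (g 0) := by
    rw [← algebraMap_stalk_eq_germ ηW, toFunctionField_algebraMap_stalk, algebraMap_map hWU]
  have hsupp : ∀ y : X.left.basicOpen h,
      IsUnitAt (y : X.left) (algebraMap Γ(X.left, U) X.left.functionField (g 0)) ↔
        (y : X.left) ∈ ((⟨Yᶜ, hY.isOpen_compl⟩ : X.left.Opens) : Set X.left) := by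
    intro y
    let yU : U := ⟨y, hWU y.2⟩
    have hhy : h ∉ (hU.primeIdealOf yU).asIdeal := (hbasic yU h).1 y.2
    change IsUnitAt (yU : X.left) _ ↔ (yU : X.left) ∉ Y
    rw [isUnitAt_algebraMap_iff hU yU (g 0), hmemY yU, hle_iff yU hhy]
  have hrad : ∀ y : X.left.basicOpen h,
      RadicalAt (y : X.left) (algebraMap Γ(X.left, U) X.left.functionField (g 0)) := by
    intro y
    let yU : U := ⟨y, hWU y.2⟩
    have hhy : h ∉ (hU.primeIdealOf yU).asIdeal := (hbasic yU h).1 y.2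
    haveI := hU.isLocalization_stalk yU
    set S := X.left.presheaf.stalk (yU : X.left) with hS
    change RadicalAt (yU : X.left) _
    rw [← toFunctionField_algebraMap_stalk yU (g 0)]
    refine radicalAt_of_isRadical ((map_ne_zero_iff _ (algebraMap_stalk_injective yU)).2 hg0) ?_
    by_cases hyY : (yU : X.left) ∈ Y
    · -- `(g₀) 𝒪_y = 𝔭 𝒪_y` is prime
      have h𝔭q : 𝔭 ≤ (hU.primeIdealOf yU).asIdeal := (hmemY yU).1 hyY
      have hmap : 𝔭.map (algebraMap Γ(X.left, U) S) = Ideal.span {algebraMap Γ(X.left, U) S (g 0)} := by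
        refine le_antisymm (Ideal.map_le_iff_le_comap.2 fun a ha ↦ ?_)
          (Ideal.span_le.2 (Set.singleton_subset_iff.2 (Ideal.mem_map_of_mem _ (hg𝔭 0))))
        have h1 := hgen a ha
        have hrange : Set.range g = {g 0} := by
          ext x
          simp only [Set.mem_range, Set.mem_singleton_iff]
          exact ⟨fun ⟨j, hj⟩ ↦ by rw [← hj, Subsingleton.elim j 0], fun hx ↦ ⟨0, hx.symm⟩⟩
        rw [hrange] at h1
        obtain ⟨w, hw⟩ := Ideal.mem_span_singleton'.1 h1
        have hunit : IsUnit (algebraMap Γ(X.left, U) S h) :=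
          IsLocalization.map_units S (⟨h, hhy⟩ : (hU.primeIdealOf yU).asIdeal.primeCompl)
        rw [Ideal.mem_comap, ← Ideal.unit_mul_mem_iff_mem _ hunit, ← map_mul, ← hw, map_mul]
        exact Ideal.mul_mem_left _ _ (Ideal.subset_span rfl)
      rw [← hmap]
      have hdisj : Disjoint ((hU.primeIdealOf yU).asIdeal.primeCompl : Set Γ(X.left, U)) 𝔭 :=
        Set.disjoint_left.2 fun a ha ha' ↦ ha (h𝔭q ha')
      exact (IsLocalization.isPrime_of_isPrime_disjoint _ S 𝔭 h𝔭prime hdisj).isRadical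
    · -- `g₀` is a unit at `y`
      have hg0y : g 0 ∉ (hU.primeIdealOf yU).asIdeal := fun hmem ↦
        hyY ((hmemY yU).2 ((hle_iff yU hhy).2 hmem))
      have hunit : IsUnit (algebraMap Γ(X.left, U) S (g 0)) :=
        IsLocalization.map_units S (⟨g 0, hg0y⟩ : (hU.primeIdealOf yU).asIdeal.primeCompl)
      rw [Ideal.span_singleton_eq_top.2 hunit]
      exact fun _ _ ↦ Submodule.mem_top
  let c₀ : ComplementDivisor.Chart (⟨Yᶜ, hY.isOpen_compl⟩ : X.left.Opens) :=
    { W := X.left.basicOpen h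
      affine := hW
      pt := ηW
      j := jW
      ne_zero := by rw [hfn]; exact (algebraMap_ne_zero_iff (V := U)).2 hg0
      supp := fun y ↦ by rw [hfn]; exact hsupp y
      rad := fun y ↦ by rw [hfn]; exact hrad y }
  refine ⟨c₀, hηh, fun m hmW hmY ↦ ?_⟩
  -- Step 5: the model `X(ℂ)` of `X^h` with algebraic charts, an analytification via `id`
  choose chart mem alg hol using fun P : ComplexPoints X ↦ exists_algebraicChart_holds X n P
  letI cs : ChartedSpace (Fin n → ℂ) (ComplexPoints X) := chartedSpaceOfCharts chart mem
  haveI hM₀ : IsManifold 𝓘(ℂ, Fin n → ℂ) ω (ComplexPoints X) :=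
    isManifold_chartedSpaceOfCharts chart mem alg hol
  have hid : IsAnalytification (Fin n → ℂ) X n (id : ComplexPoints X → ComplexPoints X) := by
    refine ⟨IsHomeomorph.id, by simp, ?_⟩
    intro V s m hm
    simp only [Set.preimage_id_eq, id_eq, Set.mem_setOf_eq] at hm
    refine MDifferentiableAt.mdifferentiableWithinAt ?_
    rw [mdifferentiableAt_iff]
    refine ⟨(AlgPoints.continuousOn_evalOrZero _ s).continuousAt
      ((AlgPoints.isOpen_setOf_pt_mem _).mem_nhds hm), ?_⟩
    simp only [writtenInExtChartAt, extChartAt, OpenPartialHomeomorph.extend,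
      modelWithCornersSelf_partialEquiv, PartialEquiv.trans_refl, modelWithCornersSelf_coe,
      Set.range_id, OpenPartialHomeomorph.toFun_eq_coe,
      OpenPartialHomeomorph.coe_toPartialEquiv_symm]
    refine DifferentiableAt.differentiableWithinAt ?_
    have hopen : IsOpen ((chart m).target ∩ (chart m).symm ⁻¹' {Q | Q.pt ∈ (↑V : X.left.Opens)}) :=
      (chart m).isOpen_inter_preimage_symm (AlgPoints.isOpen_setOf_pt_mem _)
    have hmem : chart m m ∈ (chart m).target ∩ (chart m).symm ⁻¹' {Q | Q.pt ∈ (↑V : X.left.Opens)} :=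
      ⟨(chart m).map_source (mem m), by
        simp only [Set.mem_preimage, Set.mem_setOf_eq, (chart m).left_inv (mem m)]; exact hm⟩
    exact ((hol m V s).differentiableOn (by simp)).differentiableAt (hopen.mem_nhds hmem)
  -- Step 6: the point `Q = φ m`, its maximal ideal `𝔪 = ker ev_Q ⊇ 𝔭`, `h ∉ 𝔪`
  set Q : ComplexPoints X := φ m with hQdef
  have hQW : Q.pt ∈ X.left.basicOpen h := hmW
  have hQU : Q.pt ∈ U := hWU hQW
  have hevalmem : ∀ f : Γ(X.left, U), Q.eval U hQU f = 0 ↔ f ∈ (hU.primeIdealOf ⟨Q.pt, hQU⟩).asIdeal :=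
    fun f ↦ not_iff_not.1 ((AlgPoints.pt_mem_basicOpen_iff Q hQU f).symm.trans (hbasic ⟨Q.pt, hQU⟩ f))
  have hker : RingHom.ker (Q.evalRingHom U hQU) = (hU.primeIdealOf ⟨Q.pt, hQU⟩).asIdeal :=
    Ideal.ext fun f ↦ by rw [RingHom.mem_ker, AlgPoints.evalRingHom_apply, hevalmem]
  have hkermax : (RingHom.ker (Q.evalRingHom U hQU)).IsMaximal :=
    RingHom.ker_isMaximal_of_surjective _ fun r ↦ ⟨SchemeOver.scalarRingHom X U r, by
      rw [AlgPoints.evalRingHom_apply, AlgPoints.eval_scalarRingHom]; rfl⟩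
  have h𝔭𝔪 : 𝔭 ≤ RingHom.ker (Q.evalRingHom U hQU) := by
    rw [hker]; exact (hmemY ⟨Q.pt, hQU⟩).1 hmY
  have hh𝔪 : h ∉ RingHom.ker (Q.evalRingHom U hQU) := by
    rw [hker]; exact (hbasic ⟨Q.pt, hQU⟩ h).1 hQW
  obtain ⟨hindep, t, ht, htspan⟩ := hdata _ hkermax h𝔭𝔪 hh𝔪
  have htspan' : ∀ a ∈ RingHom.ker (Q.evalRingHom U hQU), ∃ coef : Fin n → ℂ,
      a - ∑ i, SchemeOver.scalarRingHom X U (coef i) * t i ∈ RingHom.ker (Q.evalRingHom U hQU) ^ 2 := by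
    intro a ha
    obtain ⟨coef, hcoef⟩ := htspan a ha
    refine ⟨coef, ?_⟩
    simp only [Algebra.smul_def] at hcoef
    exact hcoef
  have hg' : ∀ j, g j ∈ RingHom.ker (Q.evalRingHom U hQU) := fun j ↦ h𝔭𝔪 (hg𝔭 j)
  have hindep' : ∀ coef : Fin 1 → ℂ,
      ∑ j, SchemeOver.scalarRingHom X U (coef j) * g j ∈ RingHom.ker (Q.evalRingHom U hQU) ^ 2 →
        coef = 0 := by
    intro coef hmem
    refine hindep coef ?_
    simp only [Algebra.smul_def]
    exact hmem
  -- Step 7: `dg₀ ≠ 0` in the model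
  have hsurj := surjective_pi_fderiv_chart (chart Q) (mem Q) (hol Q) ⟨U, hU⟩ hQU t htspan' (alg Q) g hg'
    hindep'
  have hfd : fderiv ℂ (evalOrZero U (g 0) ∘ (chart Q).symm) (chart Q Q) ≠ 0 := by
    intro h0
    obtain ⟨v, hv⟩ := hsurj fun _ ↦ 1
    have := congrFun hv 0
    simp [h0] at this
  have hmd : MDifferentiableOn 𝓘(ℂ, Fin n → ℂ) 𝓘(ℂ, ℂ) (evalOrZero U (g 0))
      {P : ComplexPoints X | P.pt ∈ U} := hid.mdifferentiableOn_evalOrZero ⟨U, hU⟩ (g 0)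
  have hmdQ : MDifferentiableAt 𝓘(ℂ, Fin n → ℂ) 𝓘(ℂ, ℂ) (evalOrZero U (g 0)) Q :=
    hmd.mdifferentiableAt ((AlgPoints.isOpen_setOf_pt_mem U).mem_nhds hQU)
  have hmf₀ : mfderiv 𝓘(ℂ, Fin n → ℂ) 𝓘(ℂ, ℂ) (evalOrZero U (g 0)) Q ≠ 0 := by
    have heq : mfderiv 𝓘(ℂ, Fin n → ℂ) 𝓘(ℂ, ℂ) (evalOrZero U (g 0)) Q =
        fderiv ℂ (evalOrZero U (g 0) ∘ (chart Q).symm) (chart Q Q) := by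
      rw [hmdQ.mfderiv, ModelWithCorners.range_eq_univ, fderivWithin_univ]
      rfl
    rw [heq]
    exact hfd
  -- Step 8: transport to `M` along the biholomorphism `χ : X(ℂ) ≃ M` over `X(ℂ)`
  obtain ⟨χ, hχ, -, hcomp⟩ :=
    IsAnalytification.unique_holds (E := Fin n → ℂ) (E' := E) (M := ComplexPoints X) (M' := M) hid hφ
  have hχQ : χ Q = m := hφ.isHomeomorph.injective (show φ (χ Q) = φ m from congrFun hcomp Q)
  set F : M → ℂ := fun m' ↦ evalOrZero U (g 0) (φ m') with hF
  have hFχ : F ∘ χ = evalOrZero U (g 0) := by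
    funext P
    simp only [hF, Function.comp_apply, show φ (χ P) = P from congrFun hcomp P]
  have hFd : MDifferentiableOn 𝓘(ℂ, E) 𝓘(ℂ, ℂ) F (φ ⁻¹' {P | P.pt ∈ U}) :=
    IsAnalytification.mdifferentiableOn_evalOrZero_opens_holds hφ U (g 0)
  have hmU : m ∈ φ ⁻¹' {P : ComplexPoints X | P.pt ∈ U} := hQU
  have hFat : MDifferentiableAt 𝓘(ℂ, E) 𝓘(ℂ, ℂ) F m := hFd.mdifferentiableAt ((hφ.isOpen_preimage U).mem_nhds hmU)
  have hmfF : mfderiv 𝓘(ℂ, E) 𝓘(ℂ, ℂ) F m ≠ 0 := by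
    intro h0
    apply hmf₀
    rw [← hFχ, mfderiv_comp Q (by rw [hχQ]; exact hFat) (hχ Q), hχQ, h0]
    ext v
    rfl
  -- Step 9: `j(φ m') = g₀(φ m')` near `m`
  have heq : (fun m' ↦ evalOrZero c₀.W c₀.j (φ m')) =ᶠ[𝓝 m] F := by
    filter_upwards [(hφ.isOpen_preimage (X.left.basicOpen h)).mem_nhds (show m ∈ φ ⁻¹' _ from hmW)]
      with m' hm'
    exact AlgPoints.evalOrZero_map_homOfLE hWU (g 0) hm'
  rw [heq.mfderiv_eq]
  exact hmfF

end Literature.AlgebraicGeometry.HodgeTheory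

end
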